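import Summits.QuantumFields.BalabanUV.Beta.GAN24.CombBornBorderLineage

/-!
# The (III′) Λ-born sector of the comb-chart remainder: the Λ-source at the sym Hessian table `tabs.H` in units is the Λ-piece of the UNIT-NORMALISED
# step resolvents with a `j`-free weight, `j`-uniformly local from the K-slot alone; the Λ-born remainder in units is a sum over birth levels of
# three-leg pushes through the CONJUGATED dressed leg chains from the birth level

NOT IN PRINT — OUR BOOKKEEPING (road-P2 = `b2b-balaban-gan24-p2` gen 56, 2026-08-25; row G-an2-4 ∕ (CONV-C), the (α-0) chain at row D1's literal
OF RECORD (III′) `JsB12CombShSym`; [folklore] composition BY NAME; 0 `def`, 0 cite, 0 `def … : Prop`, 0 `sorry`).  Weight 0.  NEVER «G-an2-4 closed» as (CONV-C);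
NOT D1, NOT BetaPertH, NOT continuum, NOT Clay; NO campaign opened (an2 W-4).

This is the (III′) twin of leaf-01 g59's (E) `GAN24/BornLambdaLineage` §2–§3 (the Λ-born sector, instance side) over M.51 `CombBornSector` ∕ M.56 `CombBornBorderLineage` §0,
for any sym record `tabs : SymTables d Lc` whose Hessian table is ff-VALUED (`hHff : ∀ μ y, IsFF (tabs.H μ y)` displayed — the shape of an1's `symHessFFAt`, as (E)'s
`hessFFAt_inl_inr ∕ _inr_inl ∕ _inr_inr`).  (§1 = the sector split is M.57 `CombBornSectorSplit`; §4 = the undressed ∕ contact split per lineage waits for the OWNER's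
`CombLegChainGauge.legAct_legChain_psiLeg_eq`, which replaces leaf-01 g58's `legChain_respStepBmSeq_sub_respStep` at the comb chart.)
* §1 THE Λ-SOURCE IN UNITS: `combFreshAt_lam_zero ∕ _succ`, `unitS_combFreshAt_lam_zero` (asym1's `unitS_one`), **`unitS_combFreshAt_lam_succ`** — member `j+1` in its own
  units is `(cΛ·Lc^{2(d+1)}) • SLam Lc (lamCoeffK (KStepUnit Lc (j+1)) ((smStep d Lc j)² • E2 d Lc (j+1)) Lc) tabs.H` (the OWNER's `StencilSlotLam.unitS_lamPiece_eq` proof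
  re-run on `tabs.H`: `lamCoeffK_unit`, `SLam_smul`, `unitS_smul_ffOnly`, `lam_unit_factor` BY NAME); `isFF_SLam_of_isFF`, `isFF_combFreshAt_lam`, class membership.
* §2 (V7)-Λ AT (III′): **`exists_locStencil_combLamPiece_zero`** (member `0`: lit `decays_KInv` + `abs_lamCoeffOf_le` + the record's (LH) `tabs.hH` + an2's `locStencil_SLam`),
  **`exists_hX_lam_of_unitDecayK`** (generic `d`, conditional on road P1's `UnitDecayK`: `abs_lamCoeffK_le` + `decays_E2unit` + (LH) + `locStencil_SLam`) and
  **`exists_hX_lam_three`** (`d = 3`, UNCONDITIONAL by `FibreStrip.unitDecayK_holds`): the born Λ-pieces at the sym Hessian table are local stencil families in their own units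
  with ONE constant and ONE rate for all levels.
* §3 **`unitS_combBornLam_eq_sum_push₃`**: `unitS_k (combBornOf Lc tabs cE 0 cΛ k) = unitS_k (combFreshAt tabs 0 cΛ k) + Σ_{i<k} (cE·Lc^{2(d+1)})^{k−i} • push₃ T″_i T″_i T″_i
  (unitS_i (combFreshAt tabs 0 cΛ i))`, `T″_i = legChain (fun j ↦ legComp ψ♭ R_j) i (k−1−i)` — the Λ-piece is ff-valued, so (M.51 `transport_combUnitStepMap_succ_eq_push₃` at base
  `i`) its transport is ONE push from the FIRST step on; the (E) display with `hessFFAt ρ ↦ tabs.H` and `R_j ↦ legComp ψ♭ R_j`.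
Discharges NO slot letter beyond (V7)-Λ; asserts NO shape of Bałaban's stencils; 0 wall binders.
-/

noncomputable section

open Finset
open scoped BigOperators
open Literature.MathematicalPhysics.QuantumFieldTheory
open Literature.MathematicalPhysics.QuantumFieldTheory.Balaban1983to89
open Literature.MathematicalPhysics.QuantumFieldTheory.Balaban1983to89.Beta
open B12Sec2to5 (l1)
open ExpKernelCalculus (MKer Decays VertexFamily Zl Zl_nonneg)
open AffineAveraging (Site box toSite)
open AveragingContoursRooted (ctr ctrOff)
open OneStepResolventKernel (Fib LocStencil KInv decays_KInv)
open OneStepKernelFamily (KInvStep)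
open BalabanStepJetsSucc (wVH wΛ E2 lamCoeffK abs_lamCoeffK_le)
open StepJetData (locStencil_smul)
open BalabanStepJets (lamCoeffOf abs_lamCoeffOf_le)
open InterLevelTransport (SLam locStencil_SLam)
open Summit.QuantumFields.BalabanUV.Beta.HessKerDressedUnits (unitS unitS_one locStencil_unitS)
open Summit.QuantumFields.BalabanUV.Beta.AxialDressingRooted (one_le_of_neZero)
open Summit.QuantumFields.BalabanUV.Beta.GAN24.CombesThomas (sfStep smStep sfStep_ne_zero smStep_ne_zero KStepUnit UnitDecayK)
open Summit.QuantumFields.BalabanUV.Beta.GAN24.StencilSlotOfShapes (locStencil_mono')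
open Summit.QuantumFields.BalabanUV.Beta.GAN24.StencilSlotLam (lamCoeffK_unit SLam_smul unitS_smul_ffOnly lam_unit_factor SLam_entry_zero E2_inr decays_E2unit)
open Summit.QuantumFields.BalabanUV.Beta.GAN24.Push4 (legComp IsFF)
open Summit.QuantumFields.BalabanUV.Beta.GAN24.Push4Iter (legChain)
open Summit.QuantumFields.BalabanUV.Beta.GAN24.Push3 (push₃)
open Summit.QuantumFields.BalabanUV.Beta.GAN24.AffineUnroll (transport transport_zero)
open Summit.QuantumFields.BalabanUV.Beta.GAN24.RespStepBmDecompExact (respStepBmSeq)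
open Summit.QuantumFields.BalabanUV.Beta.GAN24.SrecWilsonSector (isFF_smul isFF_unitS)
open Summit.QuantumFields.BalabanUV.Beta.GAN24.FibreStrip (unitDecayK_holds)
open Summit.QuantumFields.BalabanUV.Beta.SymCorrectorKernel (psiKS)
open Summit.QuantumFields.BalabanUV.Beta.SymmetrisedStepJets (SymTables)
open Summit.QuantumFields.BalabanUV.Beta.GAN24.CombWilsonSector (combBornOf)
open Summit.QuantumFields.BalabanUV.Beta.GAN24.CombBornSector (combFreshAt combUnitStepMap isLoc_combFreshAt isLoc_unitS transport_combUnitStepMap_succ_eq_push₃)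
open Summit.QuantumFields.BalabanUV.Beta.GAN24.CombBornBorderLineage (unitS_combBornOf_eq_sum_range)

namespace Summit.QuantumFields.BalabanUV.Beta.GAN24.CombBornLambdaLineage

variable {d : ℕ} {Lc : ℕ} [NeZero Lc] (tabs : SymTables d Lc)

/-! ## §1 The Λ-source at the sym Hessian table, in units -/

/-- [folklore] The Λ-source of member `0`: `combFreshAt tabs 0 cΛ 0 = cΛ • SLam Lc (lamCoeffOf (KInv Lc) Lc) tabs.H`. -/
theorem combFreshAt_lam_zero (cΛ : ℝ) :
    combFreshAt tabs 0 cΛ 0 = fun κ u => cΛ • SLam Lc (lamCoeffOf (KInv (N := Lc) (d := d)) Lc) tabs.H κ u := by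
  funext κ u
  simp only [combFreshAt, zero_smul, zero_add]

/-- [folklore] The Λ-source of member `j+1`: `combFreshAt tabs 0 cΛ (j+1) = (cΛ·wΛ (j+1)) • SLam Lc (lamCoeffK (KInvStep Lc (j+1)) (E2 (j+1)) Lc) tabs.H`. -/
theorem combFreshAt_lam_succ (cΛ : ℝ) (j : ℕ) :
    combFreshAt tabs 0 cΛ (j + 1) = fun κ u => (cΛ * wΛ d Lc (j + 1)) •
      SLam Lc (lamCoeffK (KInvStep (d := d) Lc (j + 1)) (E2 d Lc (j + 1)) Lc) tabs.H κ u := by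
  funext κ u
  simp only [combFreshAt, zero_mul, zero_smul, zero_add]

/-- NOT IN PRINT; OUR BOOKKEEPING ([folklore]).  **THE Λ-SOURCE OF MEMBER `0` IN UNITS** (`sfStep Lc 0 = smStep d Lc 0 = 1`: asym1's `unitS_one`). -/
theorem unitS_combFreshAt_lam_zero (cΛ : ℝ) :
    unitS (sfStep Lc 0) (smStep d Lc 0) (combFreshAt tabs 0 cΛ 0)
      = fun κ u => cΛ • SLam Lc (lamCoeffOf (KInv (N := Lc) (d := d)) Lc) tabs.H κ u := by
  rw [combFreshAt_lam_zero, show sfStep Lc 0 = 1 by simp [sfStep], show smStep d Lc 0 = 1 by simp [smStep], unitS_one]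

omit [NeZero Lc] in
/-- [folklore] **A Λ-PIECE OVER AN ff-VALUED TABLE IS ff-VALUED** (`StencilSlotLam.SLam_entry_zero`). -/
theorem isFF_SLam_of_isFF {N : ℕ} [NeZero N] {H : Fin (d + 1) → (Fin (d + 1) → ℤ) → MKer (d + 1) (Fib d)} (hHff : ∀ μ y, IsFF (H μ y))
    (c : Fin (d + 1) → (Fin (d + 1) → ℤ) → Fin (d + 1) → (Fin (d + 1) → ℤ) → ℝ) (κ : Fin (d + 1)) (u : Fin (d + 1) → ℤ) :
    IsFF (SLam N c H κ u) :=
  ⟨fun x z μ' b => SLam_entry_zero c (fun μ y => (hHff μ y).1 x z μ' b) κ u,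
    fun x z a ν' => SLam_entry_zero c (fun μ y => (hHff μ y).2 x z a ν') κ u⟩

variable (hHff : ∀ μ y, IsFF (tabs.H μ y))
include hHff

/-- NOT IN PRINT; OUR BOOKKEEPING ([folklore]; the OWNER's `StencilSlotLam.unitS_lamPiece_eq` RE-RUN on the sym Hessian table).  **THE Λ-SOURCE OF MEMBER `j+1` IN ITS OWN UNITS IS
THE Λ-PIECE OF THE UNIT-NORMALISED STEP RESOLVENTS WITH THE `j`-FREE WEIGHT `cΛ·Lc^{2(d+1)}`**:
`unitS_{j+1} (combFreshAt tabs 0 cΛ (j+1)) = (cΛ·Lc^{2(d+1)}) • SLam Lc (lamCoeffK (KStepUnit Lc (j+1)) ((smStep d Lc j)² • E2 d Lc (j+1)) Lc) tabs.H`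
(`lamCoeffK_unit`, `SLam_smul`, `unitS_smul_ffOnly` — the Λ-piece is ff-only over an ff-valued `H` —, `lam_unit_factor` BY NAME). -/
theorem unitS_combFreshAt_lam_succ (cΛ : ℝ) (j : ℕ) :
    unitS (sfStep Lc (j + 1)) (smStep d Lc (j + 1)) (combFreshAt tabs 0 cΛ (j + 1))
      = fun κ u => (cΛ * (Lc : ℝ) ^ (2 * (d + 1))) •
          SLam Lc (lamCoeffK (KStepUnit (d := d) Lc (j + 1)) ((smStep d Lc j) ^ 2 • E2 d Lc (j + 1)) Lc) tabs.H κ u := by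
  rw [combFreshAt_lam_succ]
  have hsf : sfStep Lc (j + 1) ≠ 0 := sfStep_ne_zero (j + 1)
  have hsm : smStep d Lc (j + 1) ≠ 0 := smStep_ne_zero (d := d) (j + 1)
  have ht : (smStep d Lc j) ^ 2 ≠ 0 := pow_ne_zero 2 (smStep_ne_zero (d := d) j)
  have hc : lamCoeffK (KInvStep (d := d) Lc (j + 1)) (E2 d Lc (j + 1)) Lc = fun μ y κ u =>
      ((smStep d Lc (j + 1) * sfStep Lc (j + 1))⁻¹ * ((smStep d Lc j) ^ 2)⁻¹) *
        lamCoeffK (KStepUnit (d := d) Lc (j + 1)) ((smStep d Lc j) ^ 2 • E2 d Lc (j + 1)) Lc μ y κ u := by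
    funext μ y κ u
    exact lamCoeffK_unit hsf hsm ht _ _ (fun y z ν b => E2_inr (j + 1) y z ν b) Lc μ y κ u
  rw [hc, SLam_smul]
  have hfun : (fun κ u => (cΛ * wΛ d Lc (j + 1)) •
      (fun κ u => ((smStep d Lc (j + 1) * sfStep Lc (j + 1))⁻¹ * ((smStep d Lc j) ^ 2)⁻¹) •
        SLam Lc (lamCoeffK (KStepUnit (d := d) Lc (j + 1)) ((smStep d Lc j) ^ 2 • E2 d Lc (j + 1)) Lc) tabs.H κ u) κ u)
      = fun κ u => ((cΛ * wΛ d Lc (j + 1)) * (((smStep d Lc (j + 1) * sfStep Lc (j + 1))⁻¹ * ((smStep d Lc j) ^ 2)⁻¹))) •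
        SLam Lc (lamCoeffK (KStepUnit (d := d) Lc (j + 1)) ((smStep d Lc j) ^ 2 • E2 d Lc (j + 1)) Lc) tabs.H κ u := by
    funext κ u
    rw [smul_smul]
  have hF := isFF_SLam_of_isFF (N := Lc) hHff (lamCoeffK (KStepUnit (d := d) Lc (j + 1)) ((smStep d Lc j) ^ 2 • E2 d Lc (j + 1)) Lc)
  rw [hfun, unitS_smul_ffOnly _ _ _ _ (fun κ u x y α ν => (hF κ u).2 x y (Sum.inl α) ν)
    (fun κ u x y ν α => (hF κ u).1 x y ν (Sum.inl α)) (fun κ u x y ν ν' => (hF κ u).1 x y ν (Sum.inr ν'))]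
  funext κ u
  congr 1
  rw [← mul_assoc]
  exact lam_unit_factor cΛ j

/-- [folklore] The Λ-source is ff-valued at every level. -/
theorem isFF_combFreshAt_lam (cΛ : ℝ) : ∀ (j : ℕ) (κ : Fin (d + 1)) (u : Fin (d + 1) → ℤ), IsFF (combFreshAt tabs 0 cΛ j κ u)
  | 0, κ, u => by rw [combFreshAt_lam_zero]; exact isFF_smul (isFF_SLam_of_isFF hHff _ κ u) _
  | j + 1, κ, u => by rw [combFreshAt_lam_succ]; exact isFF_smul (isFF_SLam_of_isFF hHff _ κ u) _

omit hHff in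
/-- [folklore] The Λ-source in units is in the class of local stencil families (M.51 `isLoc_combFreshAt` + asym1's `locStencil_unitS`). -/
theorem isLoc_unitS_combFreshAt_lam (cE cΛ : ℝ) (j : ℕ) (sf sm : ℝ) :
    ∃ Cs δ : ℝ, 0 < δ ∧ LocStencil (unitS sf sm (combFreshAt tabs 0 cΛ j)) Cs δ :=
  isLoc_unitS sf sm (isLoc_combFreshAt tabs cE 0 cΛ j)

/-! ## §2 (V7)-Λ at the comb chart: `j`-uniform locality of the born Λ-pieces in their own units -/

omit hHff in
/-- NOT IN PRINT; OUR BOOKKEEPING ([folklore]; the (III′) twin of leaf-01's `exists_locStencil_lamPiece_zero`).  **MEMBER `0`'s Λ-PIECE AT THE SYM HESSIAN TABLE IS A LOCAL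
STENCIL FAMILY** (lit `decays_KInv` + `abs_lamCoeffOf_le` for the coefficients; the record's (LH) `tabs.hH` for the table; an2's `locStencil_SLam`). -/
theorem exists_locStencil_combLamPiece_zero (cΛ : ℝ) :
    ∃ C δ : ℝ, 0 < δ ∧ LocStencil (fun κ u => cΛ • SLam Lc (lamCoeffOf (KInv (N := Lc) (d := d)) Lc) tabs.H κ u) C δ := by
  obtain ⟨δ₀, C, hδ₀, hC, hdec⟩ := decays_KInv (N := Lc) (d := d)
  have hc := abs_lamCoeffOf_le (N := Lc) hdec hC hδ₀.le
  obtain ⟨CH, hQ⟩ := tabs.hH δ₀ hδ₀.le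
  have h3 := locStencil_SLam (N := Lc) hc hQ hδ₀ (mul_nonneg (mul_nonneg (by positivity) hC) (Real.exp_pos _).le)
  exact ⟨_, δ₀ / 2, by positivity, locStencil_smul cΛ h3⟩

/-- NOT IN PRINT; OUR BOOKKEEPING ([folklore]; the OWNER's `StencilSlotLam.locStencil_unitS_lamPiece` RE-RUN on the sym Hessian table).  **`hS`-SHAPE FOR THE Λ-SOURCE OF
MEMBER `j+1`, UNIFORMLY IN `j`, FROM THE K-SLOT'S DECAY HALF**: `UnitDecayK d Lc (sfStep Lc) (smStep d Lc) C δ` (`0 < δ`) and the record's (LH) at rate `δ∕2` with constant `CH`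
give ONE `j`-free constant and the rate `δ∕4` for every member `j+1`. -/
theorem locStencil_unitS_combFreshAt_lam_succ {C δ CH : ℝ} (hK : UnitDecayK d Lc (sfStep Lc) (smStep d Lc) C δ) (hδ : 0 < δ)
    (hQ : VertexFamily tabs.H Lc CH (δ / 2)) (cΛ : ℝ) (j : ℕ) :
    LocStencil (unitS (sfStep Lc (j + 1)) (smStep d Lc (j + 1)) (combFreshAt tabs 0 cΛ (j + 1)))
      (|cΛ * (Lc : ℝ) ^ (2 * (d + 1))| * ((d + 1 : ℕ) * (((Fintype.card (Fib d) : ℝ) * (C * C) * Zl (d + 1) (δ - δ / 2)) * CH * Zl (d + 1) (δ / 2 / 2))))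
      (δ / 2 / 2) := by
  rw [unitS_combFreshAt_lam_succ tabs hHff]
  have hA : Decays (KStepUnit (d := d) Lc (j + 1)) C δ := hK (j + 1)
  have hE : Decays ((smStep d Lc j) ^ 2 • E2 d Lc (j + 1)) C δ := decays_E2unit (hK j) hδ.le
  have hC : 0 ≤ C := hA.nonneg (Sum.inl 0)
  have hc := abs_lamCoeffK_le hA hE hδ Lc
  have hS := locStencil_SLam (N := Lc) hc hQ (by positivity)
    (mul_nonneg (mul_nonneg (Nat.cast_nonneg _) (mul_nonneg hC hC)) (Zl_nonneg (by linarith)))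
  exact StepJetData.locStencil_smul _ hS

/-- NOT IN PRINT; OUR BOOKKEEPING ((V7)-Λ at (III′) in `LocStencil` form, generic `d`, CONDITIONAL on road P1's `UnitDecayK`; the twin of leaf-01's `exists_hX_lam_of_unitDecayK`).
**THE BORN Λ-PIECES AT THE SYM HESSIAN TABLE ARE LOCAL STENCIL FAMILIES IN THEIR OWN UNITS WITH ONE CONSTANT AND ONE RATE FOR ALL LEVELS.** -/
theorem exists_hX_lam_of_unitDecayK {CK δK : ℝ} (hK : UnitDecayK d Lc (sfStep Lc) (smStep d Lc) CK δK) (hδK : 0 < δK) (cΛ : ℝ) :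
    ∃ C δ : ℝ, 0 < δ ∧ ∀ k : ℕ, LocStencil (unitS (sfStep Lc k) (smStep d Lc k) (combFreshAt tabs 0 cΛ k)) C δ := by
  obtain ⟨C0, δ0, hδ0, h0⟩ := exists_locStencil_combLamPiece_zero tabs cΛ
  obtain ⟨CH, hQ⟩ := tabs.hH (δK / 2) (by positivity)
  set C1 : ℝ := |cΛ * (Lc : ℝ) ^ (2 * (d + 1))| *
    ((d + 1 : ℕ) * (((Fintype.card (Fib d) : ℝ) * (CK * CK) * Zl (d + 1) (δK - δK / 2)) * CH * Zl (d + 1) (δK / 2 / 2))) with hC1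
  refine ⟨max C0 C1, min δ0 (δK / 2 / 2), lt_min hδ0 (by positivity), fun k => ?_⟩
  cases k with
  | zero =>
    rw [unitS_combFreshAt_lam_zero]
    exact locStencil_mono' h0 (le_max_left _ _) (min_le_left _ _)
  | succ j =>
    exact locStencil_mono' (locStencil_unitS_combFreshAt_lam_succ tabs hHff hK hδK hQ cΛ j) (le_max_right _ _) (min_le_right _ _)

omit hHff in
/-- NOT IN PRINT; OUR BOOKKEEPING ((V7)-Λ at (III′) in `LocStencil` form, `d = 3`, UNCONDITIONAL; the twin of leaf-01's `exists_hX_lam_three`).  **THE BORN Λ-PIECES OF THE `d = 3`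
COMB-CHART REMAINDER ARE LOCAL STENCIL FAMILIES IN THEIR OWN UNITS, UNIFORMLY IN THE LEVEL** — road P1's (I3′) `FibreStrip.unitDecayK_holds` discharges the unit decay. -/
theorem exists_hX_lam_three {Lc : ℕ} [NeZero Lc] (tabs : SymTables 3 Lc) (hHff : ∀ μ y, IsFF (tabs.H μ y)) (cΛ : ℝ) :
    ∃ C δ : ℝ, 0 < δ ∧ ∀ k : ℕ, LocStencil (unitS (sfStep Lc k) (smStep 3 Lc k) (combFreshAt tabs 0 cΛ k)) C δ := by
  obtain ⟨κ, hκ, Cst, hK⟩ := unitDecayK_holds (Lc := Lc)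
  have hrate : 0 < κ / ((3 + 1) * (Lc : ℝ)) := by
    have : (0 : ℝ) < (Lc : ℝ) := by exact_mod_cast Nat.pos_of_ne_zero (NeZero.ne Lc)
    positivity
  exact exists_hX_lam_of_unitDecayK (d := 3) tabs hHff hK hrate cΛ

/-! ## §3 The Λ-born remainder in units: weighted three-leg pushes through the conjugated chains from the birth level -/

/-- NOT IN PRINT; OUR BOOKKEEPING ([folklore]; the (III′) twin of leaf-01's `unitS_bornLam_eq_sum_push₃`).  **THE (III′) Λ-BORN REMAINDER, MEMBER `k`, IN THE ADOPTED UNITS, IS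
THE FRESH Λ-SOURCE PLUS A SUM OVER EARLIER BIRTH LEVELS OF WEIGHTED THREE-LEG PUSHES OF THE BORN Λ-PIECES THROUGH THE CONJUGATED DRESSED LEG CHAINS FROM THEIR BIRTH LEVEL**:
`unitS_k (combBornOf Lc tabs cE 0 cΛ k) = unitS_k (combFreshAt tabs 0 cΛ k) + Σ_{i<k} (cE·Lc^{2(d+1)})^{k−i} • push₃ T″_i T″_i T″_i (unitS_i (combFreshAt tabs 0 cΛ i))`,
`T″_i = legChain (fun j ↦ legComp ψ♭ R_j) i (k−1−i)` — the Λ-piece is ff-valued (§1), so its transport is ONE push from the FIRST step on (M.51 `transport_combUnitStepMap_succ_eq_push₃`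
at base `m = i`; M.56 §0 `unitS_combBornOf_eq_sum_range`). -/
theorem unitS_combBornLam_eq_sum_push₃ (cE cΛ : ℝ) (k : ℕ) :
    unitS (sfStep Lc k) (smStep d Lc k) (combBornOf Lc tabs cE 0 cΛ k)
      = unitS (sfStep Lc k) (smStep d Lc k) (combFreshAt tabs 0 cΛ k)
        + ∑ i ∈ Finset.range k, fun κ' u' => (cE * (Lc : ℝ) ^ (2 * (d + 1))) ^ (k - i) •
            push₃
              (legChain (fun j => legComp (fun α x κ u => psiKS (ctrOff (d + 1) Lc) Lc u x (Sum.inl κ) (Sum.inl α)) (respStepBmSeq (ctr (d + 1) Lc) Lc j)) i (k - 1 - i))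
              (legChain (fun j => legComp (fun α x κ u => psiKS (ctrOff (d + 1) Lc) Lc u x (Sum.inl κ) (Sum.inl α)) (respStepBmSeq (ctr (d + 1) Lc) Lc j)) i (k - 1 - i))
              (legChain (fun j => legComp (fun α x κ u => psiKS (ctrOff (d + 1) Lc) Lc u x (Sum.inl κ) (Sum.inl α)) (respStepBmSeq (ctr (d + 1) Lc) Lc j)) i (k - 1 - i))
              (unitS (sfStep Lc i) (smStep d Lc i) (combFreshAt tabs 0 cΛ i)) κ' u' := by
  rw [unitS_combBornOf_eq_sum_range tabs cE 0 cΛ k, Finset.sum_range_succ, Nat.sub_self, transport_zero]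
  refine (add_comm _ _).trans ?_
  congr 1
  refine Finset.sum_congr rfl fun i hi => ?_
  have hik : i < k := Finset.mem_range.1 hi
  obtain ⟨n, hn⟩ : ∃ n, k - i = n + 1 := ⟨k - 1 - i, by omega⟩
  have hn' : k - 1 - i = n := by omega
  rw [hn, hn', transport_combUnitStepMap_succ_eq_push₃ cE i (fun κ u => isFF_unitS (isFF_combFreshAt_lam tabs hHff cΛ i) _ _ κ u)
    (isLoc_unitS_combFreshAt_lam tabs cE cΛ i _ _) n]

end Summit.QuantumFields.BalabanUV.Beta.GAN24.CombBornLambdaLineage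

end
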